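import Mathlib
import HarnessLib
import Summits.KontsevichZagierPeriods.KontsevichZagierPeriods.Theses.HurwitzMicroSectors

/-!
# Sketch — crux-ideate round 1, ideator 3 (gen 2), crux `ReductionTwoSix` (stmt-KontsevichZagierPeriods-3871)

First lemmas of the two idea cards of this seat, stated over existing declarations (nothing is
proved here except the two pointwise identities at the end; the Props only have to ELABORATE):

* card `euler-stokes-polynomial-descent`: `EulerStokesDescent`, `IntervalPolyNull`, `PolyPartNull`,
  the equivalence-form dilation instances `DilAt m`, and the FINITE-ENGINE transfer `FiniteEngine`;
* card `cartan-homotopy-dilation`: `phiIso`, `CornerIntegrable`, `HomotopyLift`, `FaceKill`,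
  `HomotopyDilation` (= `∀ m ≥ 1, DilAt m` obtained from rules 1), 3) and coordinate permutations).
-/

noncomputable section

set_option linter.dupNamespace false

open MeasureTheory Set Polynomial

namespace Summit.KontsevichZagierPeriods.KontsevichZagierPeriods.Cruxes.ReductionTwoSix.SketchIdeator3G2

open Literature.NumberTheory.Transcendental
open Summit.KontsevichZagierPeriods.KontsevichZagierPeriods.Theses.HurwitzMicroSectors

/-- The open unit box of `ℝⁿ`, literally the set of the crux. -/
abbrev box (n : ℕ) : Set (Fin n → ℝ) := {x | ∀ i, x i ∈ Set.Ioo (0:ℝ) 1}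

/-- `a₀(Q) = Σ_k Q_k/(k+1)²` — the constant the polynomial part `Q(xy)` integrates to on the box. -/
def polyConst (Q : ℚ[X]) : ℚ :=
  ∑ k ∈ Finset.range (Q.natDegree + 1), Q.coeff k / ((k : ℚ) + 1) ^ 2

/-! ## Card `euler-stokes-polynomial-descent` -/

/-- **Euler–Stokes descent (2 → 1).** On the open box, `((X·H)')(x₀x₁) = ∂/∂x₁ [x₁ · H(x₀x₁)]`
(Euler field), the primitive `F(x₀,x₁) = x₁ H(x₀x₁)` is a polynomial, `F(x₀,1) − F(x₀,0) = H(x₀)`: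
ONE Newton–Leibniz move (plus the null faces `x₁ ∈ {0,1}` by domain additivity) takes the box
representation of `((X·H)')(x₀x₁)` to the interval representation of `H`. -/
def EulerStokesDescent : Prop :=
  ∀ (H : ℚ[X]) (r : KZ.IntegralRep 2) (r' : KZ.IntegralRep 1),
    r.domain = box 2 → r'.domain = box 1 →
    Set.EqOn r.integrand (fun x => aeval (x 0 * x 1) (derivative (X * H))) r.domain →
    Set.EqOn r'.integrand (fun x => aeval (x 0) H) r'.domain →
    KZ.Equivalent r r'

/-- **Interval step (1 → 0).** A polynomial with zero integral over `(0,1)` is a relation: one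
Newton–Leibniz move to the point (`IntegralRep 0`) with the polynomial primitive, whose boundary
term is the ZERO constant, and a zero representation is a relation. -/
def IntervalPolyNull : Prop :=
  ∀ (H : ℚ[X]) (r' : KZ.IntegralRep 1), r'.domain = box 1 →
    Set.EqOn r'.integrand (fun x => aeval (x 0) H) r'.domain →
    (∑ k ∈ Finset.range (H.natDegree + 1), H.coeff k / ((k : ℚ) + 1)) = 0 →
    KZ.of r' ∈ KZ.relations

/-- **Polynomial part is null** (the whole polynomial part at once, rules 1a), 1b), 3) only; no
change of variables, no dilation `m = k+1`): `[box², Q(x₀x₁) − a₀(Q)] ∈ relations`. From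
`EulerStokesDescent` with `H = Σ Q_k X^k/(k+1) − a₀(Q)` and `IntervalPolyNull`. -/
def PolyPartNull : Prop :=
  ∀ (Q : ℚ[X]) (r : KZ.IntegralRep 2), r.domain = box 2 →
    Set.EqOn r.integrand (fun x => aeval (x 0 * x 1) Q - (polyConst Q : ℝ)) r.domain →
    KZ.of r ∈ KZ.relations

/-- The dilation instance `(n, m) = (2, m)` in EQUIVALENCE form (conclusion `KZ.Equivalent`, weaker
than item DilationMove's membership in `changeOfVariablesRel`; this is all the crux consumes, and it
is the form card `cartan-homotopy-dilation` delivers without rule 2)). -/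
def DilAt (m : ℕ) : Prop :=
  ∀ (r r' : KZ.IntegralRep 2), r.domain = box 2 → r'.domain = box 2 →
    (∀ x ∈ r.domain,
      r.integrand x = r'.integrand (fun i => x i ^ m) * ((m : ℝ) ^ 2 * ∏ i, x i ^ (m - 1))) →
    KZ.Equivalent r r'

/-- **FINITE ENGINE** (card α's transfer `C⁺ → crux`): the polynomial part by Stokes and exactly TWO
box self-maps `Φ₂, Φ₃` for the four Kubert relations give `ReductionTwoSix` (the composition is
`Disproof.lean` §9 with `S_q6_mul` re-proved from `PolyPartNull` instead of `S_dil_monomial`). -/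
def FiniteEngine : Prop :=
  PolyPartNull → DilAt 2 → DilAt 3 →
    IntegrableOn (fun x : Fin 2 → ℝ => 1 / (1 - x 0 * x 1)) (box 2) → ReductionTwoSix

/-! ## Card `cartan-homotopy-dilation` -/

/-- The linear isotopy of self-maps of `(0,1)` from `id` to `z ↦ z^m`: `φ_s(z) = z + s (z^m − z)`
(polynomial in `(s, z)`; `φ_s(0) = 0`, `φ_s(1) = 1`, `φ_s' > 0` on `(0,1)` for `s ∈ [0,1]`). -/
def phiIso (m : ℕ) (s z : ℝ) : ℝ := z + s * (z ^ m - z)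

/-- `∂_z φ_s`. -/
def dphiIso (m : ℕ) (s z : ℝ) : ℝ := 1 + s * ((m : ℝ) * z ^ (m - 1) - 1)

/-- velocity `∂_s φ_s(z) = z^m − z` — vanishes on the faces `z ∈ {0, 1}`. -/
def velIso (m : ℕ) (z : ℝ) : ℝ := z ^ m - z

/-- Pull-back of `g(uv) du dv` along `Φ_s = φ_s × φ_s`: the integrand `W`. -/
def cartanW (g : ℝ → ℝ) (m : ℕ) (x y s : ℝ) : ℝ :=
  g (phiIso m s x * phiIso m s y) * dphiIso m s x * dphiIso m s y

/-- The `dy`-component `B` of `Φ_s^* ι_V (g du dv)` (carries the factor `velIso m x`). -/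
def cartanB (g : ℝ → ℝ) (m : ℕ) (x y s : ℝ) : ℝ :=
  g (phiIso m s x * phiIso m s y) * velIso m x * dphiIso m s y

/-- The `dx`-component `A` of `Φ_s^* ι_V (g du dv)` (carries the factor `velIso m y`). -/
def cartanA (g : ℝ → ℝ) (m : ℕ) (x y s : ℝ) : ℝ :=
  - (g (phiIso m s x * phiIso m s y) * velIso m y * dphiIso m s x)

/-- **Cartan homotopy identity** `∂_s W = ∂_x B − ∂_y A` (pointwise, for differentiable `g`):
`d/ds Φ_s^*ω = d(Φ_s^* ι_{V_s} ω)`. Checked symbolically for `m = 2, 3, 4` (job j009166). -/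
def CartanIdentity (m : ℕ) : Prop :=
  ∀ (g : ℝ → ℝ), Differentiable ℝ g → ∀ x y s : ℝ,
    deriv (fun σ => cartanW g m x y σ) s =
      deriv (fun ξ => cartanB g m ξ y s) x - deriv (fun η => cartanA g m x η s) y

/-- **L¹ legitimacy at the singular corner**: the worst Cartan term is dominated by
`(1 − x₀)/(1 − x₀x₁)² + 1/(1 − x₀x₁)`, and `∫_box (1 − x₀)/(1 − x₀x₁)² = 1`. -/
def CornerIntegrable : Prop :=
  IntegrableOn (fun x : Fin 2 → ℝ => (1 - x 0) / (1 - x 0 * x 1) ^ 2) (box 2)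

/-- **Homotopy lift (2 → 3)**: `[box², W(·,·,1) − W(·,·,0)]` is ONE Newton–Leibniz move (base the
open box, `a ≡ 0`, `b ≡ 1`, primitive `W` itself — RATIONAL) away from `[box² × [0,1], ∂_s W]`. -/
def HomotopyLift : Prop :=
  ∀ (W : (Fin 3 → ℝ) → ℝ) (r : KZ.IntegralRep 3) (r' : KZ.IntegralRep 2),
    r'.domain = box 2 →
    r.domain = {z | (Fin.init z : Fin 2 → ℝ) ∈ box 2 ∧ (0 : ℝ) ≤ z (Fin.last 2) ∧ z (Fin.last 2) ≤ 1} →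
    IsSemialgebraicFunOn ℚ r.domain W →
    (∀ x ∈ box 2, ContinuousOn (fun t : ℝ => W (Fin.snoc x t)) (Set.Icc 0 1)) →
    (∀ x ∈ box 2, ∀ t ∈ Set.Ioo (0 : ℝ) 1,
      HasDerivAt (fun σ : ℝ => W (Fin.snoc x σ)) (r.integrand (Fin.snoc x t)) t) →
    (∀ x ∈ box 2, r'.integrand x = W (Fin.snoc x 1) - W (Fin.snoc x 0)) →
    KZ.Equivalent r r'

/-- **Face kill**: on the open box of `ℝ³`, an (absolutely integrable) derivative `∂₀ B` along
coordinate `0` of a semialgebraic `B` continuous on the closed `x₀`-fibres and VANISHING on the faces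
`x₀ ∈ {0,1}` is a relation (coordinate permutation = linear change of variables with `|det| = 1`,
null faces by domain additivity, Newton–Leibniz with primitive `B`, zero boundary representation). -/
def FaceKill : Prop :=
  ∀ (B : (Fin 3 → ℝ) → ℝ) (r : KZ.IntegralRep 3), r.domain = box 3 →
    IsSemialgebraicFunOn ℚ {z : Fin 3 → ℝ | z 0 ∈ Set.Icc (0:ℝ) 1 ∧ z 1 ∈ Set.Ioo (0:ℝ) 1 ∧
      z 2 ∈ Set.Ioo (0:ℝ) 1} B →
    (∀ z ∈ box 3, ContinuousOn (fun t : ℝ => B (Function.update z 0 t)) (Set.Icc 0 1)) →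
    (∀ z ∈ box 3, HasDerivAt (fun t : ℝ => B (Function.update z 0 t)) (r.integrand z) (z 0)) →
    (∀ z ∈ box 3, B (Function.update z 0 0) = 0 ∧ B (Function.update z 0 1) = 0) →
    KZ.of r ∈ KZ.relations

/-- **Dilations are Stokes one dimension up**: every `DilAt m` from `HomotopyLift`, `FaceKill`
(twice: `∂_x B`, `∂_y A`), integrand additivity and `CornerIntegrable`-type bounds — no instance of
rule 2) other than coordinate permutations. -/
def HomotopyDilation : Prop := ∀ m : ℕ, 1 ≤ m → DilAt m

/-! ## Two pointwise sanity identities (proved) -/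

/-- Euler primitive: `∂_y [y · H(xy)] = H(xy) + xy · H'(xy) = (t H)'|_{t = xy}` — here for the
monomial `H = t^k`: `∂_y (y (xy)^k) = (k+1) (xy)^k`. -/
theorem euler_primitive_monomial (k : ℕ) (x y : ℝ) :
    HasDerivAt (fun η : ℝ => η * (x * η) ^ k) (((k : ℝ) + 1) * (x * y) ^ k) y := by
  have h1 : HasDerivAt (fun η : ℝ => x ^ k * η ^ (k + 1)) (x ^ k * (((k : ℝ) + 1) * y ^ k)) y := by
    have h := (hasDerivAt_pow (k + 1) y).const_mul (x ^ k)
    simp only [Nat.add_sub_cancel, Nat.cast_add, Nat.cast_one] at h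
    exact h
  have h2 : (fun η : ℝ => η * (x * η) ^ k) = fun η => x ^ k * η ^ (k + 1) := by
    funext η; rw [mul_pow]; ring
  have h3 : ((k : ℝ) + 1) * (x * y) ^ k = x ^ k * (((k : ℝ) + 1) * y ^ k) := by
    rw [mul_pow]; ring
  rw [h2, h3]; exact h1

/-- The isotopy fixes the faces: `φ_s(0) = 0`, `φ_s(1) = 1`, and its velocity vanishes there. -/
theorem phiIso_faces (m : ℕ) (hm : 1 ≤ m) (s : ℝ) :
    phiIso m s 0 = 0 ∧ phiIso m s 1 = 1 ∧ velIso m 0 = 0 ∧ velIso m 1 = 0 := by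
  have hm0 : m ≠ 0 := by omega
  simp [phiIso, velIso, zero_pow hm0]

end Summit.KontsevichZagierPeriods.KontsevichZagierPeriods.Cruxes.ReductionTwoSix.SketchIdeator3G2
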